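import Summits.Schanuel.Schanuel.Theorems.ZilberEacTranscendenceDensity
import Summits.Schanuel.Schanuel.Theorems.ZilberEacNewtonBranch
import HarnessLib

/-!
# Arbitrary base branches, XLIII: THE CONICS `x₁² = x₀² + p₁x₀ + p₀` — the small branch at
# infinity and the TRANSCENDENCE of the exact relation `y₁ = θ'e^{η(1/x₀)}`

HONEST FRAMING.  Cell `pub-schanuel` (Zilber's Exponential-Algebraic Closedness, case ladder;
host summit Schanuel), seat 2, gen 29.  Over a conic `C : x₁² = P(x₀)`, `P = x₀² + p₁x₀ + p₀` with
`c := p₀ − p₁²/4 ≠ 0` (simple roots), both places at infinity have RATIONAL slope `±1` and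
`x₁ ∓ x₀ → ±p₁/2`: along the exponential points `x₀ = τ + 2πin` no coordinate grows, and the growth
route of files XIX–XLII is void (`(k, deg P) = (2, 2)`, the excluded pair).  Instead there is an
EXACT RELATION: on the place `x₁ − x₀ → p₁/2`, `x₁ = x₀ + p₁/2 + η(1/x₀)` with `η` analytic,
`η(0) = 0`, `uη² + (2 + p₁u)η − cu = 0` (implicit function theorem), so for the constant fibre
`y₀ = θ` the exponential points satisfy `y₁ = θe^{p₁/2}·e^{η(1/x₀)}` — THEOREM T of gen 22
(`unprojectedDense_of_transcendental_relation`) gives density once `u ↦ θe^{p₁/2}e^{η(u)}` admits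
no algebraic relation with `1/u`.  That transcendence (**`conic_exp_relation_transcendental`**) is
proved by the RATIONAL PARAMETRISATION `v = x₁ − x₀ − p₁/2`, `x₀ = (c − p₁v − v²)/(2v)`: a relation
near `u = 0` transports (the small root is unique by Vieta) to `H(x₀(v), θ'e^{v}) = 0` near `v = 0`,
propagates to all `v ≠ 0` by the identity theorem, and dies as `v → −∞` against the superdecay
lemma of the cell's Literature file (`eq_zero_of_eval₂_eq_zero_of_superdecay`).  Hence
**`unprojectedDensityQuestion_conic_constFibre`**: `{x₁² − P(x₀) = 0, y₀ = θ}` is in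
Mantova–Masser's case AND dense for every monic quadratic `P` with simple roots and every `θ ≠ 0` —
the last pair `(k, deg P) = (2, 2)` for constant fibres.  Decided instances of an OPEN question
(Mantova–Masser, PLMS 2024 §1 p. 5); EC(3,2) OPEN; NOT Schanuel's conjecture; EAC ⇏ SC.
-/

noncomputable section

open Filter Topology Set Complex Polynomial
open Literature.NumberTheory.Transcendental Literature.ModelTheory.Zilber
open Literature.ModelTheory.ExponentialFields

set_option linter.dupNamespace false

namespace Summit.Schanuel.Schanuel.Theorems

/-! ## Part A. The small branch `η` and its rational inverse -/

/-- **The small root at infinity.**  For `c ≠ 0` there is `η` analytic at `0`, `η(0) = 0`, with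
`u·η(u)² + (2 + p₁u)η(u) − cu = 0` near `0` (the branch `x₁ − x₀ − p₁/2 = η(1/x₀)` of the conic
`x₁² = x₀² + p₁x₀ + p₀`, `c = p₀ − p₁²/4`). [folklore] -/
theorem exists_conic_branch (p₁ c : ℂ) :
    ∃ η : ℂ → ℂ, AnalyticAt ℂ η 0 ∧ η 0 = 0 ∧
      ∀ᶠ u in 𝓝 (0 : ℂ), u * η u ^ 2 + (2 + p₁ * u) * η u - c * u = 0 := by
  -- `Q(u, X) = u X² + (2 + p₁ u) X − c u`
  set Q : ℂ[X][X] := Polynomial.C (Polynomial.X : ℂ[X]) * Polynomial.X ^ 2 +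
    Polynomial.C (2 + Polynomial.C p₁ * Polynomial.X) * Polynomial.X -
    Polynomial.C (Polynomial.C c * Polynomial.X) with hQ
  have hQeval : ∀ u x : ℂ, (Q.map (Polynomial.evalRingHom u)).eval x =
      u * x ^ 2 + (2 + p₁ * u) * x - c * u := by
    intro u x
    simp [hQ]
  have hab : (Q.map (Polynomial.evalRingHom 0)).IsRoot 0 := by
    rw [Polynomial.IsRoot, hQeval]; ring
  have hab' : ¬ ((derivative Q).map (Polynomial.evalRingHom 0)).IsRoot 0 := by
    rw [Polynomial.IsRoot]
    simp [hQ]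
  obtain ⟨η, hηan, hη0, hηQ⟩ := exists_branchAt Q hab hab'
  refine ⟨η, hηan, hη0, ?_⟩
  filter_upwards [hηQ] with u hu
  rwa [hQeval] at hu

/-- **Transcendence of the conic relation.**  `η` as above (`c ≠ 0`), `θ' ≠ 0`: there is no
nonzero `H ∈ ℂ[x][y]` with `H(1/u, θ'e^{η(u)}) = 0` for all small `u ≠ 0`. [folklore] (new in this
form) -/
theorem conic_exp_relation_transcendental {p₁ c θ' : ℂ} (hc : c ≠ 0) (hθ' : θ' ≠ 0) {η : ℂ → ℂ}
    (hηan : AnalyticAt ℂ η 0) (hη0 : η 0 = 0)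
    (hηQ : ∀ᶠ u in 𝓝 (0 : ℂ), u * η u ^ 2 + (2 + p₁ * u) * η u - c * u = 0)
    (H : ℂ[X][X]) (hH0 : H ≠ 0) :
    ¬ ∀ᶠ u in 𝓝[≠] (0 : ℂ), (H.map (Polynomial.evalRingHom u⁻¹)).eval (θ' * Complex.exp (η u)) = 0 := by
  intro hrel
  -- the rational inverse `U(v) = 2v/(c − p₁ v − v²)` and `x₀(v) = 1/U(v)`
  set D : ℂ → ℂ := fun v => c - p₁ * v - v ^ 2 with hD
  have hDan : ∀ v, AnalyticAt ℂ D v := fun v => by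
    simp only [hD]; fun_prop
  have hD0 : D 0 = c := by simp [hD]
  have hDne : ∀ᶠ v in 𝓝 (0 : ℂ), D v ≠ 0 := (hDan 0).continuousAt.eventually_ne (by rw [hD0]; exact hc)
  set U : ℂ → ℂ := fun v => 2 * v / D v with hU
  have hUan : AnalyticAt ℂ U 0 := (analyticAt_const.mul analyticAt_id).div (hDan 0) (by rw [hD0]; exact hc)
  have hU0 : U 0 = 0 := by simp [hU]
  have hUt0 : Tendsto U (𝓝 (0 : ℂ)) (𝓝 0) := by
    have h := hUan.continuousAt.tendsto; rwa [hU0] at h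
  have hUne : ∀ᶠ v in 𝓝[≠] (0 : ℂ), U v ≠ 0 := by
    filter_upwards [nhdsWithin_le_nhds hDne, self_mem_nhdsWithin] with v hDv (hv : v ≠ 0)
    exact div_ne_zero (mul_ne_zero two_ne_zero hv) hDv
  have hUt : Tendsto U (𝓝[≠] (0 : ℂ)) (𝓝[≠] 0) :=
    tendsto_nhdsWithin_iff.2 ⟨hUt0.mono_left nhdsWithin_le_nhds, hUne⟩
  -- `v` is a root of the quadratic at `u = U(v)`, and it is THE small root: `η(U(v)) = v`
  have hvroot : ∀ᶠ v in 𝓝 (0 : ℂ), U v * v ^ 2 + (2 + p₁ * U v) * v - c * U v = 0 := by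
    filter_upwards [hDne] with v hDv
    have hneg : v ^ 2 + p₁ * v - c = -(D v) := by simp only [hD]; ring
    calc U v * v ^ 2 + (2 + p₁ * U v) * v - c * U v
        = U v * (v ^ 2 + p₁ * v - c) + 2 * v := by ring
      _ = 2 * v / D v * (-(D v)) + 2 * v := by rw [hneg]
      _ = 0 := by rw [mul_neg, div_mul_cancel₀ _ hDv]; ring
  have hηU : ∀ᶠ v in 𝓝[≠] (0 : ℂ), η (U v) = v := by
    -- if `η(U v) ≠ v`, Vieta: `η(U v) + v = −(2 + p₁ U v)/U v`, unbounded — but both roots are small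
    have hηUt : Tendsto (fun v => η (U v)) (𝓝[≠] (0 : ℂ)) (𝓝 0) := by
      have h := hηan.continuousAt.tendsto
      rw [hη0] at h
      exact (h.comp hUt0).mono_left nhdsWithin_le_nhds
    have hsum : Tendsto (fun v => U v * (η (U v) + v) + p₁ * U v) (𝓝[≠] (0 : ℂ)) (𝓝 0) := by
      have hv : Tendsto (fun v : ℂ => v) (𝓝[≠] (0 : ℂ)) (𝓝 0) := tendsto_id.mono_left nhdsWithin_le_nhds
      have hU' := hUt0.mono_left (nhdsWithin_le_nhds (s := {(0 : ℂ)}ᶜ))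
      have h := (hU'.mul (hηUt.add hv)).add (hU'.const_mul p₁)
      simpa using h
    have hfar : ∀ᶠ v in 𝓝[≠] (0 : ℂ), ‖U v * (η (U v) + v) + p₁ * U v‖ < 1 := by
      have := (tendsto_order.1 (tendsto_zero_iff_norm_tendsto_zero.1 hsum)).2 1 one_pos
      exact this
    filter_upwards [hUt.eventually (eventually_nhdsWithin_of_eventually_nhds hηQ),
      nhdsWithin_le_nhds hvroot, hUne, hfar] with v h1 h2 hUv hfar
    by_contra hne
    -- subtract the two root equations and divide by `η(U v) − v`
    have hdiff : U v * (η (U v) + v) + (2 + p₁ * U v) = 0 := by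
      have h3 : (η (U v) - v) * (U v * (η (U v) + v) + (2 + p₁ * U v)) = 0 := by
        linear_combination h1 - h2
      rcases mul_eq_zero.1 h3 with h | h
      · exact absurd (sub_eq_zero.1 h) hne
      · exact h
    have : U v * (η (U v) + v) + p₁ * U v = -2 := by linear_combination hdiff
    rw [this, norm_neg] at hfar
    norm_num at hfar
  -- the relation in the `v`-chart, for small `v ≠ 0`
  set x₀ : ℂ → ℂ := fun v => (U v)⁻¹ with hx₀
  set K : ℂ → ℂ := fun v => (H.map (Polynomial.evalRingHom (x₀ v))).eval (θ' * Complex.exp v)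
    with hK
  have hKsmall : ∀ᶠ v in 𝓝[≠] (0 : ℂ), K v = 0 := by
    filter_upwards [hUt.eventually hrel, hηU] with v hv hηv
    simp only [hK, hx₀]
    rw [hηv] at hv
    exact hv
  -- `K` is analytic on `{v ≠ 0}` (where `x₀(v) = D(v)/(2v)`)
  have hx₀eq : ∀ v : ℂ, v ≠ 0 → x₀ v = D v / (2 * v) := by
    intro v hv
    simp only [hx₀, hU, inv_div]
  have hKan : AnalyticOnNhd ℂ K {(0 : ℂ)}ᶜ := by
    intro v hv
    have hv0 : v ≠ 0 := hv
    have hx₀an : AnalyticAt ℂ x₀ v := by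
      have h : AnalyticAt ℂ (fun v => D v / (2 * v)) v :=
        (hDan v).div (analyticAt_const.mul analyticAt_id) (mul_ne_zero two_ne_zero hv0)
      refine h.congr ?_
      filter_upwards [isOpen_compl_singleton.mem_nhds hv0] with v' hv'
      exact (hx₀eq v' hv').symm
    -- expand `H` over its coefficients
    have hKeq : K = fun v => ∑ j ∈ Finset.range (H.natDegree + 1),
        Polynomial.aeval (x₀ v) (H.coeff j) * (θ' * Complex.exp v) ^ j := by
      funext v
      simp only [hK]
      rw [Polynomial.eval_map, Polynomial.eval₂_eq_sum_range]
      refine Finset.sum_congr rfl fun j _ => ?_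
      rw [Polynomial.coe_evalRingHom, Polynomial.coe_aeval_eq_eval]
    rw [hKeq]
    refine Finset.analyticAt_fun_sum _ fun j _ => ?_
    exact (hx₀an.aeval_polynomial (H.coeff j)).mul
      ((analyticAt_const.mul analyticAt_cexp).pow j)
  -- identity theorem on the punctured plane: `K ≡ 0` on `{v ≠ 0}`
  have hKzero : EqOn K 0 {(0 : ℂ)}ᶜ := by
    obtain ⟨ε, hε, hball⟩ : ∃ ε > 0, ∀ v : ℂ, v ≠ 0 → dist v 0 < ε → K v = 0 := by
      rw [eventually_nhdsWithin_iff, Metric.eventually_nhds_iff] at hKsmall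
      obtain ⟨ε, hε, h⟩ := hKsmall
      exact ⟨ε, hε, fun v hv hd => h hd hv⟩
    set v₀ : ℂ := ((ε / 2 : ℝ) : ℂ) with hv₀
    have hv₀0 : v₀ ≠ 0 := by
      rw [hv₀]; exact_mod_cast (by positivity : (ε / 2 : ℝ) ≠ 0)
    have hpre : IsPreconnected ({(0 : ℂ)}ᶜ : Set ℂ) :=
      (isConnected_compl_singleton_of_one_lt_rank (by rw [Complex.rank_real_complex]; norm_num)
        (0 : ℂ)).isPreconnected
    refine hKan.eqOn_zero_of_preconnected_of_eventuallyEq_zero hpre (z₀ := v₀) hv₀0 ?_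
    have hnhds : Metric.ball v₀ (ε / 2) ∈ 𝓝 v₀ := Metric.ball_mem_nhds _ (by positivity)
    filter_upwards [hnhds] with v hv
    have hvε : dist v 0 < ε := by
      have h1 : dist v v₀ < ε / 2 := Metric.mem_ball.1 hv
      have h2 : dist v₀ 0 = ε / 2 := by
        rw [hv₀, dist_zero_right, Complex.norm_real, Real.norm_eq_abs, abs_of_pos (by positivity)]
      linarith [dist_triangle v v₀ 0]
    have hvne : v ≠ 0 := by
      intro h
      rw [h, Metric.mem_ball, dist_comm] at hv
      have h2 : dist v₀ 0 = ε / 2 := by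
        rw [hv₀, dist_zero_right, Complex.norm_real, Real.norm_eq_abs, abs_of_pos (by positivity)]
      linarith
    exact hball v hvne hvε
  -- along `v = −(t+1)`, `t ∈ ℕ`: `x₀ → ∞` linearly, `θ'e^{v}` decays super-polynomially
  set z : ℕ → ℂ := fun t => x₀ (-((t : ℂ) + 1)) with hz
  set w : ℕ → ℂ := fun t => θ' * Complex.exp (-((t : ℂ) + 1)) with hw
  have hzeq : ∀ t : ℕ, z t = (c + p₁ * ((t : ℂ) + 1) - ((t : ℂ) + 1) ^ 2) / (-(2 * ((t : ℂ) + 1))) := by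
    intro t
    have ht : (-((t : ℂ) + 1)) ≠ 0 := neg_ne_zero.2 (by exact_mod_cast Nat.succ_ne_zero t)
    rw [hz]
    simp only
    rw [hx₀eq _ ht, hD]
    ring
  have hznorm : Tendsto (fun t => ‖z t‖) atTop atTop := by
    -- `‖z t‖ ≥ (t+1)/2 − |p₁|/2 − |c|/2`
    have hlow : ∀ t : ℕ, ((t : ℝ) + 1) / 2 - ‖p₁‖ / 2 - ‖c‖ / 2 ≤ ‖z t‖ := by
      intro t
      have ht1 : (0 : ℝ) < (t : ℝ) + 1 := by positivity
      have htC : ‖((t : ℂ) + 1)‖ = (t : ℝ) + 1 := by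
        rw [show ((t : ℂ) + 1) = (((t : ℝ) + 1 : ℝ) : ℂ) by push_cast; ring, Complex.norm_real,
          Real.norm_eq_abs, abs_of_pos ht1]
      rw [hzeq, norm_div, norm_neg, norm_mul, Complex.norm_ofNat, htC]
      rw [le_div_iff₀ (by positivity)]
      have h1 : ‖((t : ℂ) + 1) ^ 2‖ = ((t : ℝ) + 1) ^ 2 := by rw [norm_pow, htC]
      have h2 : ‖c + p₁ * ((t : ℂ) + 1)‖ ≤ ‖c‖ + ‖p₁‖ * ((t : ℝ) + 1) := by
        refine (norm_add_le _ _).trans ?_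
        rw [norm_mul, htC]
      have h3 : ((t : ℝ) + 1) ^ 2 - (‖c‖ + ‖p₁‖ * ((t : ℝ) + 1)) ≤
          ‖c + p₁ * ((t : ℂ) + 1) - ((t : ℂ) + 1) ^ 2‖ := by
        have := norm_sub_norm_le (((t : ℂ) + 1) ^ 2) (c + p₁ * ((t : ℂ) + 1))
        rw [norm_sub_rev] at this
        linarith
      nlinarith [norm_nonneg c, norm_nonneg p₁]
    refine tendsto_atTop_mono hlow ?_
    have h : Tendsto (fun t : ℕ => ((t : ℝ) + 1) / 2) atTop atTop := by
      refine Tendsto.atTop_div_const (by norm_num) ?_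
      exact tendsto_atTop_add_const_right _ 1 tendsto_natCast_atTop_atTop
    exact tendsto_atTop_add_const_right _ _ (tendsto_atTop_add_const_right _ _ h)
  have hw0 : ∀ t, w t ≠ 0 := fun t => mul_ne_zero hθ' (Complex.exp_ne_zero _)
  have hdec : ∀ N : ℕ, Tendsto (fun t => ‖w t‖ * ‖z t‖ ^ N) atTop (𝓝 0) := by
    intro N
    -- `‖z t‖ ≤ (t+1) + B`, `‖w t‖ = ‖θ'‖e^{−(t+1)}`
    set B : ℝ := ‖c‖ + ‖p₁‖ + 1 with hB
    have hB1 : ‖c‖ + ‖p₁‖ + 1 = B := hB.symm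
    have hzup : ∀ t : ℕ, ‖z t‖ ≤ ((t : ℝ) + 1) + B := by
      intro t
      have ht1 : (1 : ℝ) ≤ (t : ℝ) + 1 := by
        have : (0 : ℝ) ≤ t := Nat.cast_nonneg t
        linarith
      have htC : ‖((t : ℂ) + 1)‖ = (t : ℝ) + 1 := by
        rw [show ((t : ℂ) + 1) = (((t : ℝ) + 1 : ℝ) : ℂ) by push_cast; ring, Complex.norm_real,
          Real.norm_eq_abs, abs_of_pos (by positivity)]
      rw [hzeq, norm_div, norm_neg, norm_mul, Complex.norm_ofNat, htC, div_le_iff₀ (by positivity)]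
      have h2 : ‖c + p₁ * ((t : ℂ) + 1) - ((t : ℂ) + 1) ^ 2‖ ≤
          ‖c‖ + ‖p₁‖ * ((t : ℝ) + 1) + ((t : ℝ) + 1) ^ 2 := by
        refine (norm_sub_le _ _).trans ?_
        rw [norm_pow, htC]
        refine add_le_add ((norm_add_le _ _).trans ?_) le_rfl
        rw [norm_mul, htC]
      rw [← hB1]
      nlinarith [norm_nonneg c, norm_nonneg p₁]
    clear_value B
    have hwn : ∀ t : ℕ, ‖w t‖ = ‖θ'‖ * Real.exp (-((t : ℝ) + 1)) := by
      intro t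
      rw [hw]
      simp only [norm_mul]
      rw [show (-((t : ℂ) + 1)) = ((-((t : ℝ) + 1) : ℝ) : ℂ) by push_cast; ring,
        Complex.norm_exp_ofReal]
    -- compare with `s ↦ (s + B)^N e^{-s}` along `s = t + 1 → ∞`
    have hmain : Tendsto (fun s : ℝ => (s + B) ^ N * Real.exp (-s)) atTop (𝓝 0) := by
      have h := (Real.tendsto_pow_mul_exp_neg_atTop_nhds_zero N).comp
        (tendsto_atTop_add_const_right atTop B tendsto_id)
      have hconst : Tendsto (fun s : ℝ => Real.exp B * ((s + B) ^ N * Real.exp (-(s + B)))) atTop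
          (𝓝 (Real.exp B * 0)) := h.const_mul _
      rw [mul_zero] at hconst
      refine hconst.congr fun s => ?_
      rw [neg_add, Real.exp_add, Real.exp_neg B]
      field_simp
    have hs : Tendsto (fun t : ℕ => (t : ℝ) + 1) atTop atTop :=
      tendsto_atTop_add_const_right _ 1 tendsto_natCast_atTop_atTop
    have hlim := (hmain.comp hs).const_mul ‖θ'‖
    rw [mul_zero] at hlim
    refine squeeze_zero (fun t => by positivity) (fun t => ?_) hlim
    simp only [Function.comp_apply]
    rw [hwn t]
    have hexp : 0 < Real.exp (-((t : ℝ) + 1)) := Real.exp_pos _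
    calc ‖θ'‖ * Real.exp (-((t : ℝ) + 1)) * ‖z t‖ ^ N
        ≤ ‖θ'‖ * Real.exp (-((t : ℝ) + 1)) * (((t : ℝ) + 1) + B) ^ N := by
          exact mul_le_mul_of_nonneg_left (pow_le_pow_left₀ (norm_nonneg _) (hzup t) N)
            (by positivity)
      _ = ‖θ'‖ * ((((t : ℝ) + 1) + B) ^ N * Real.exp (-((t : ℝ) + 1))) := by ring
  have hG : ∀ t, H.eval₂ (Polynomial.evalRingHom (z t)) (w t) = 0 := by
    intro t
    have ht : (-((t : ℂ) + 1)) ∈ ({(0 : ℂ)}ᶜ : Set ℂ) := by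
      simp only [Set.mem_compl_iff, Set.mem_singleton_iff, neg_eq_zero]
      exact_mod_cast Nat.succ_ne_zero t
    have h := hKzero ht
    simp only [hK, Pi.zero_apply, Polynomial.eval_map] at h
    exact h
  exact hH0 (eq_zero_of_eval₂_eq_zero_of_superdecay H z w hznorm hw0 hdec hG)

/-- **On the branch `x₁ = 1/u + p₁/2 + η(u)` of the conic: `x₁² = P(1/u)`** (`P(x) = x² + p₁x + p₀`,
`u·e² + (2 + p₁u)e − (p₀ − p₁²/4)u = 0`, `u ≠ 0`). [folklore] -/
theorem conic_sheet_sq {p₁ p₀ : ℂ} {P : ℂ[X]} (hPev : ∀ x : ℂ, P.eval x = x ^ 2 + p₁ * x + p₀)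
    {u e : ℂ} (hu : u ≠ 0) (hq : u * e ^ 2 + (2 + p₁ * u) * e - (p₀ - p₁ ^ 2 / 4) * u = 0) :
    (u⁻¹ + p₁ / 2 + e) ^ 2 = P.eval u⁻¹ := by
  rw [hPev]
  have h : (u⁻¹ + p₁ / 2 + e) ^ 2 - ((u⁻¹) ^ 2 + p₁ * u⁻¹ + p₀) =
      u⁻¹ * (u * e ^ 2 + (2 + p₁ * u) * e - (p₀ - p₁ ^ 2 / 4) * u) := by
    field_simp
    ring
  rw [hq, mul_zero, sub_eq_zero] at h
  exact h

end Summit.Schanuel.Schanuel.Theorems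

end
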